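import Literature.MathematicalPhysics.QuantumFieldTheory.Balaban1983to89.B12Eq43ContourFormula
import Literature.MathematicalPhysics.QuantumFieldTheory.Balaban1983to89.B11Eq183Differentiation

/-!
# Bałaban, *Renormalization group approach to lattice gauge field theories. I* (CMP 109, 1987) [Balaban1987RG1], p. 282: the block bound
# «the norm in (4.4) of ⟨δ^{n(p)}𝐇_j(□₀,0)/δB^{n(p)}, ⊗_{i∈N(p)} B_i⟩ can be estimated by B₃ Π_{i∈N(p)} |B_i|» DERIVED from the analyticity
# of the chart, and the inner map of (4.2)–(4.3)/(4.5) INSTANTIATED at [15]'s Landau-gauge chart (179) (`B11Eq183Differentiation.chartH179`)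

HONEST FRAMING (cell `lit-balaban`, verbatim): statement-level skeleton of published theorems with citation tags; proofs where landed; nothing here is a claim about the Yang–Mills mass gap.

PDF held: `paper:balaban1987-cmp109-rg-i-small-field` (journal page = PDF page + 248); p. 282 [PDF 34] read as an image by this seat
(render `pub-balaban/b2b-balaban-ref1/pages/1987-cmp109-rg-I-small-field/…-p034-x2.png`, 2026-08-21); [15] = T. Bałaban, *The variational
problem and background fields in renormalization group method for lattice gauge theories*, CMP **102** (1985) 277–309 [Balaban1985Variational]
(cell paper B11), Prop. 9 p. 309 and (179)–(180) p. 306 as typed in `B11Eq174Chart` / `B11Eq183Differentiation` (r08).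

WHAT IS REPRODUCED: SKELETON rows **B12.Eq4.2-4.3** / **B12.Eq4.5** (display owner r09, fold owner r20; referee ref-5), the p. 282 [PDF 34]
sentence, verbatim: *«The functional derivative (δ^{n(p)})/(δB^{n(p)})𝐇_j(□₀, 0) is given by a sum of several perturbative expressions discussed
in Sect. G [15]. Each expression corresponds to a tree graph with n(p) initial points and one final point, and it has an exponential decay in
a length of this graph. The derivative has an exponential decay in a length of a shortest tree graph of this type. The norm in (4.4) of the
expression ⟨δ^{n(p)}/δB^{n(p)} 𝐇_j(□₀, 0), ⊗_{i∈N(p)} B_i⟩ can be estimated by B₃ Π_{i∈N(p)} |B_i|, and if one of the functions B_i is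
localized outside the domain X, then we have the additional exponential factor exp(−δ₀dist^{(ξ)}(X, supp B_i)).»* — the hypothesis `hv` of the
(4.3) ⇒ (4.5) kernel `B12Repr43.norm_iteratedFDeriv_comp_le` (pv12) — together with that kernel's inner-map hypotheses `hH` (`B ↦ 𝐇_j(□₀,B)`
of class `Cⁿ` at `0`) and `hH0` (`𝐇_j(□₀, 0) = 0`), which pv12's docstring lists as *«Remaining named leaves … (`hH`, `hH0`; [15])»*.

WHAT IS CERTIFIED (kernel, sorry-free; axioms standard; theorems only — no definition, no new named fact).
§1 (generic, pv12's abstract setting `H : W → E`, `E` complete):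
* **`norm_blockIns_le_of_analytic`** — the NON-LOCALISED HALF of the p. 282 sentence FROM ANALYTICITY: if `H` is analytic on an open
  `U_W ⊇ {‖B‖ < a}` with `‖H‖ ≤ S_H` on that ball, then every block insertion `v_p = ⟨δ^{n(p)}H(0), ⊗_{i∈N(p)}B_i⟩` (`B12Repr43.blockIns`) obeys
  `‖v_p‖ ≤ S_H (2n(p)/a)^{n(p)} Π_{i∈N(p)} ‖B_i‖` (pv12's iterated Cauchy estimate `B12Repr43.norm_iteratedFDeriv_apply_le_of_ball`, i.e. the
  third member of (4.3) `B12Eq43ContourFormula.iteratedFDeriv_apply_eq_torusIntegral` estimated on the contours `|τ_q| = a/(2n(p)‖B_i‖)`);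
  `norm_blockIns_le_uniform` — the same with ONE constant `B₃ := S_H·max{1, 2n/a}ⁿ` for all blocks of all partitions of `{1,…,n}`
  (`pow_partSize_le`).  ROUTE NOTE: print obtains `B₃Π|B_i|` from the Sect. G [15] tree-graph expansions; the Cauchy route gives the same
  SHAPE from Prop. 9's analyticity alone; the LOCALISED factor `exp(−δ₀dist^{(ξ)}(X, supp B_i))` is Sect. G decay (190) and is NOT derived
  here (it stays the hypothesis `hvloc`).
* **`norm_iteratedFDeriv_comp_le_of_analytic`** — pv12's (4.5)-bound `B12Repr43.norm_iteratedFDeriv_comp_le` with `hv`, `hH` DISCHARGED for an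
  analytic bounded inner map (`hH0`, `hvloc` kept): `‖Dⁿ(f∘H)(0)[B]‖ ≤ (2n²B₃/α₂)ⁿ·S·W₀·Π‖B_i‖`, `B₃ = S_H·max{1,2n/a}ⁿ`.
§2 (the inner map = [15]'s chart (179), `B11Eq183Differentiation.chartH179 𝒢 W D2 H₀ Tm ε₄ : 𝒳 → 𝒴` over the Sect. E–G contraction scheme —
abstract complex Banach spaces `𝒳 ∋ B`, `𝒴`, `𝒵`, data `𝒢, W = (δ/δA′)V, D2 = Δ⁽²⁾, H₀, Tm = the Sect. C map (47)`, a `B11Eq174Chart.Regime`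
((117)–(121)), Prop. 4's analyticity letter `hWa`, `Tm` analytic and `K`-Lipschitz on `{‖Y‖ < ε₄ + a}` with `Tm 0 = 0`, and a radius `r` with
`‖B‖ < r ⇒ ‖H₀B‖ < a ∧ ‖Δ⁽²⁾H₀B‖ < j`):
* `chartH179_zero` — `𝓗(0) = 0` (`hH0`; `B11Eq174Chart.Regime.chartH_zero`: Prop. 9's `U_k(V′V₀)U_k(V₀)⁻¹` at `V′ = 1`);
* `norm_chartH179_le` — `‖𝓗(B)‖ ≤ K(ε₄ + a)` on the parameter domain (`Regime.norm_chartH_le`, the norm form of (173)/[I] (3.27));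
* `contDiffAt_chartH179_zero` — `hH`: the chart is `Cⁿ` (indeed analytic, r08 `analyticOnNhd_chartH179`) at `0`;
* **`norm_blockIns_chartH179_le`** — the p. 282 block bound FOR THE [15] CHART: `‖⟨δ^{n(p)}𝓗(0), ⊗_{i∈N(p)}B_i⟩‖ ≤ K(ε₄+a)(2n(p)/r)^{n(p)}Π‖B_i‖`;
* **`faaDiBruno_torusIntegral_chartH179`** — THE WHOLE CHAIN (4.3) (`B12Eq43ContourFormula.faaDiBruno_torusIntegral`, p05 g8) with the inner map
  `B ↦ 𝓗(B)` = [15]'s chart: `hH`, `hH0` DISCHARGED;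
* **`norm_iteratedFDeriv_comp_chartH179_le`** — the (4.5)-type bound with the chart: `hH`, `hH0`, `hv` DISCHARGED (`B₃ = K(ε₄+a)·max{1,2n/r}ⁿ`),
  `hvloc` (localised factor `W₀`) and the outer data ((4.4) analyticity of `f` on `U ⊇ {‖𝐇‖ < α₂}`, (1.18) sup `S`) kept as in pv12.
MODELLING / HONEST SCOPE.  (M1) pv12's DIVERGENCE D-pv12.3/6 stands: `‖·‖` on `𝒴` plays «the norm in (4.4)» and `‖B_i‖` plays `|B_i|`; the
scheme's (115)-norm and the (4.4)-functional are identified only at this abstract level (no lattice operator of [15] is constructed — `𝒢`,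
`(δ/δA′)V`, `Δ⁽²⁾`, `H₀`, `Tm` are DATA, exactly as in `B11Eq174Chart`/`B11Eq183Differentiation`).  (M2) `B₃` here is an explicit Cauchy
constant, not print's Sect. G constant; the localised exponential factor is not derived.  (M3) `𝐇_j(□₀,·)` vs `𝓗`: [I] (3.27) identifies
the block chart with [15]'s Prop. 9 chart for the `(k+1)`-st problem on `□₀` (READING recorded in `B11Eq174Chart`'s header, not a theorem).
Mega-formalization `lit-balaban`, HOME `run/shared/lean/pub/lit-balaban/`, Phase-2 proof seat p05 gen 8 (unit `lit-balaban-p05`).  Imports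
`…B12Eq43ContourFormula` (p05 g8) and `…B11Eq183Differentiation` (r08 g9) only; modifies nothing there.
-/

noncomputable section

open Set Metric Filter Finset Complex MeasureTheory
open scoped Topology BigOperators

namespace Literature.MathematicalPhysics.QuantumFieldTheory.Balaban1983to89.B12Eq45BlockBound

open Literature.MathematicalPhysics.QuantumFieldTheory.Balaban1983to89
open B12Ineq45 B12Repr43 B12Eq43ContourFormula B11Prop6Scheme B11Eq174Chart B11Eq183Differentiation

/-! ## §1. The p. 282 block bound from analyticity (pv12's abstract carriers) -/

section Generic

variable {W : Type*} [NormedAddCommGroup W] [NormedSpace ℂ W]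
  {E : Type*} [NormedAddCommGroup E] [NormedSpace ℂ E] [CompleteSpace E]
  {F : Type*} [NormedAddCommGroup F] [NormedSpace ℂ F] [CompleteSpace F]

/-- **p. 282, «the norm … of ⟨δ^{n(p)}/δB^{n(p)} 𝐇_j(□₀,0), ⊗_{i∈N(p)} B_i⟩ can be estimated by B₃ Π_{i∈N(p)} |B_i|», FROM ANALYTICITY**: for
`H` analytic on an open `U_W ⊇ {‖B‖ < a}` and bounded by `S_H` there, the block insertion of the block `N(p)` of a partition `c` satisfies
`‖⟨δ^{n(p)}H(0), ⊗_{i∈N(p)}B_i⟩‖ ≤ S_H (2n(p)/a)^{n(p)} Π_{i∈N(p)} ‖B_i‖` (iterated Cauchy estimate on the contours `|τ_q| = a/(2n(p)‖B_i‖)`).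
[cite: Balaban1987RG1, p.282] -/
theorem norm_blockIns_le_of_analytic {UW : Set W} (hUW : IsOpen UW) {a SH : ℝ} (ha : 0 < a) (hball : ball (0 : W) a ⊆ UW)
    {H : W → E} (hH : AnalyticOnNhd ℂ H UW) (hSH : ∀ y ∈ ball (0 : W) a, ‖H y‖ ≤ SH) {n : ℕ} (B : Fin n → W)
    (c : OrderedFinpartition n) (p : Fin c.length) :
    ‖blockIns (𝕜 := ℂ) H 0 B c p‖ ≤ SH * (2 * (c.partSize p : ℝ) / a) ^ c.partSize p * ∏ q, ‖B (c.emb p q)‖ :=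
  norm_iteratedFDeriv_apply_le_of_ball hUW ha hball hH hSH (B ∘ c.emb p) (fun q => ‖B (c.emb p q)‖)
    (fun _ => norm_nonneg _) fun _ => le_rfl

/-- The per-block Cauchy constants are dominated by one constant: `(2n(p)/a)^{n(p)} ≤ max{1, 2n/a}ⁿ` since `n(p) ≤ n`.
[cite: Balaban1987RG1, p.282] -/
theorem pow_partSize_le {a : ℝ} (ha : 0 < a) {n : ℕ} (c : OrderedFinpartition n) (p : Fin c.length) :
    (2 * (c.partSize p : ℝ) / a) ^ c.partSize p ≤ (max 1 (2 * (n : ℝ) / a)) ^ n := by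
  have hm : c.partSize p ≤ n := c.partSize_le p
  have hmr : (c.partSize p : ℝ) ≤ n := by exact_mod_cast hm
  calc (2 * (c.partSize p : ℝ) / a) ^ c.partSize p ≤ (max 1 (2 * (n : ℝ) / a)) ^ c.partSize p := by
        refine pow_le_pow_left₀ (by positivity) ((le_max_right _ _).trans' ?_) _
        exact div_le_div_of_nonneg_right (by linarith) ha.le
    _ ≤ (max 1 (2 * (n : ℝ) / a)) ^ n := pow_le_pow_right₀ (le_max_left _ _) hm

/-- **The p. 282 sentence with ONE constant `B₃ := S_H·max{1, 2n/a}ⁿ`** for all blocks of all partitions of `{1,…,n}`: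
`‖⟨δ^{n(p)}H(0), ⊗_{i∈N(p)}B_i⟩‖ ≤ B₃ Π_{i∈N(p)} ‖B_i‖` — the hypothesis `hv` of `B12Repr43.norm_iteratedFDeriv_comp_le`, for an analytic
bounded inner map. [cite: Balaban1987RG1, p.282] -/
theorem norm_blockIns_le_uniform {UW : Set W} (hUW : IsOpen UW) {a SH : ℝ} (ha : 0 < a) (hball : ball (0 : W) a ⊆ UW)
    {H : W → E} (hH : AnalyticOnNhd ℂ H UW) (hSH : ∀ y ∈ ball (0 : W) a, ‖H y‖ ≤ SH) {n : ℕ} (B : Fin n → W)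
    (c : OrderedFinpartition n) (p : Fin c.length) :
    ‖blockIns (𝕜 := ℂ) H 0 B c p‖ ≤ SH * (max 1 (2 * (n : ℝ) / a)) ^ n * ∏ q, ‖B (c.emb p q)‖ := by
  have hS0 : 0 ≤ SH := (norm_nonneg _).trans (hSH 0 (mem_ball_self ha))
  refine (norm_blockIns_le_of_analytic hUW ha hball hH hSH B c p).trans ?_
  exact mul_le_mul_of_nonneg_right (mul_le_mul_of_nonneg_left (pow_partSize_le ha c p) hS0)
    (Finset.prod_nonneg fun _ _ => norm_nonneg _)

/-- **(4.3) + (4.4) + (1.18) + p. 282 ⇒ the (4.5)-bound, with `hv` and `hH` DISCHARGED for an analytic bounded inner map** (pv12's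
`B12Repr43.norm_iteratedFDeriv_comp_le` with `B₃ := S_H·max{1,2n/a}ⁿ`; the localised factor `W₀` of the blocks meeting `out` stays the
hypothesis `hvloc`, the Sect. G [15] decay): `‖Dⁿ(f∘H)(0)[B_1,…,B_n]‖ ≤ (2n²B₃/α₂)ⁿ · S · W₀ · Π_i ‖B_i‖`.
[cite: Balaban1987RG1, (4.3)–(4.5) pp.281–282] -/
theorem norm_iteratedFDeriv_comp_le_of_analytic {U : Set E} (hU : IsOpen U) {α₂ S : ℝ} (hα : 0 < α₂)
    (hballE : ball (0 : E) α₂ ⊆ U) {f : E → F} (hf : AnalyticOnNhd ℂ f U) (hS : ∀ y ∈ ball (0 : E) α₂, ‖f y‖ ≤ S)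
    {UW : Set W} (hUW : IsOpen UW) {a SH : ℝ} (ha : 0 < a) (hball : ball (0 : W) a ⊆ UW)
    {H : W → E} (hH : AnalyticOnNhd ℂ H UW) (hSH : ∀ y ∈ ball (0 : W) a, ‖H y‖ ≤ SH) (hH0 : H 0 = 0)
    {n : ℕ} (B : Fin n → W) {W₀ : ℝ} (hW0 : 0 ≤ W₀) (hW1 : W₀ ≤ 1)
    (hB : α₂ ≤ 2 * (SH * (max 1 (2 * (n : ℝ) / a)) ^ n)) (out : Fin n → Prop) (i₀ : Fin n) (hi₀ : out i₀)
    (hvloc : ∀ (c : OrderedFinpartition n) (p : Fin c.length), (∃ q, out (c.emb p q)) →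
      ‖blockIns (𝕜 := ℂ) H 0 B c p‖ ≤ W₀ * ((SH * (max 1 (2 * (n : ℝ) / a)) ^ n) * ∏ q, ‖B (c.emb p q)‖)) :
    ‖iteratedFDeriv ℂ n (f ∘ H) 0 B‖ ≤
      (2 * (n : ℝ) ^ 2 * (SH * (max 1 (2 * (n : ℝ) / a)) ^ n) / α₂) ^ n * S * W₀ * ∏ i, ‖B i‖ :=
  norm_iteratedFDeriv_comp_le hU hα hballE hf hS hB hW0 hW1 ((hH 0 (hball (mem_ball_self ha))).contDiffAt) hH0 B out i₀ hi₀
    (fun c p => norm_blockIns_le_uniform hUW ha hball hH hSH B c p) hvloc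

end Generic

/-! ## §2. The inner map = [15]'s Landau-gauge chart (179) -/

section Chart

variable {𝒳 𝒴 𝒵 : Type*} [NormedAddCommGroup 𝒳] [NormedSpace ℂ 𝒳] [NormedAddCommGroup 𝒴] [NormedSpace ℂ 𝒴]
  [NormedAddCommGroup 𝒵] [NormedSpace ℂ 𝒵] [CompleteSpace 𝒳] [CompleteSpace 𝒴] [CompleteSpace 𝒵]
  {𝒢 : 𝒵 →L[ℂ] 𝒴} {W : 𝒴 → 𝒵} {D2 : 𝒴 →L[ℂ] 𝒵} {H₀ : 𝒳 →L[ℂ] 𝒴} {B₀ θ C₄ a₃ j a ε₄ : ℝ}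

omit [CompleteSpace 𝒳] [CompleteSpace 𝒵] in
/-- **`𝐇_j(□₀, 0) = 0` for [15]'s chart (179)** (the hypothesis `hH0` of (4.3)/(4.5)): at `B = 0` the source `−Δ⁽²⁾H₀B` and the shift
`H₀B` vanish and Prop. 9's chart is `Tm(𝒜₀(0) + 0) = Tm 0 = 0` (`B11Eq174Chart.Regime.chartH_zero`). [cite: Balaban1987RG1, (4.3) p.281] -/
theorem chartH179_zero (R : Regime 𝒢 0 W B₀ θ C₄ a₃ j a ε₄) (hj : 0 ≤ j) (ha : 0 < a) {Tm : 𝒴 → 𝒴} (hT0 : Tm 0 = 0) :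
    chartH179 𝒢 W D2 H₀ Tm ε₄ 0 = 0 := by
  show chartH 𝒢 0 W (-(D2 (H₀ 0))) Tm ε₄ (H₀ 0) = 0
  rw [map_zero, map_zero, neg_zero]
  exact R.chartH_zero hj ha hT0

omit [CompleteSpace 𝒳] [CompleteSpace 𝒵] in
/-- **The chart is bounded on the parameter domain**: `‖𝓗(B)‖ ≤ K(ε₄ + a)` whenever `‖H₀B‖ < a`, `‖Δ⁽²⁾H₀B‖ ≤ j`, for `Tm` `K`-Lipschitz on
`{‖Y‖ < ε₄ + a}` with `Tm 0 = 0` (`B11Eq174Chart.Regime.norm_chartH_le`, the norm form of (173) [15] / (3.27) [I]) — the sup `S_H` of §1.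
[cite: Balaban1987RG1, (3.27) p.275] -/
theorem norm_chartH179_le (R : Regime 𝒢 0 W B₀ θ C₄ a₃ j a ε₄) {Tm : 𝒴 → 𝒴} {K : ℝ} (hK : 0 ≤ K) (hT0 : Tm 0 = 0)
    (hT : ∀ x y : 𝒴, ‖x‖ < ε₄ + a → ‖y‖ < ε₄ + a → ‖Tm x - Tm y‖ ≤ K * ‖x - y‖)
    {B : 𝒳} (h𝔄 : ‖H₀ B‖ < a) (hJ : ‖D2 (H₀ B)‖ ≤ j) :
    ‖chartH179 𝒢 W D2 H₀ Tm ε₄ B‖ ≤ K * (ε₄ + a) := by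
  have h := (R.norm_chartH_le (J := -(D2 (H₀ B))) (T := Tm) (by rwa [norm_neg]) h𝔄 hK hT0 hT).2
  refine (show chartH179 𝒢 W D2 H₀ Tm ε₄ B = chartH 𝒢 0 W (-(D2 (H₀ B))) Tm ε₄ (H₀ B) from rfl) ▸ h.trans ?_
  exact mul_le_mul_of_nonneg_left (by linarith) hK

/-- **`hH` for [15]'s chart**: `B ↦ 𝓗(B)` is `Cⁿ` at `0` — indeed analytic on the open parameter domain
(`B11Eq183Differentiation.analyticOnNhd_chartH179`, Prop. 9 «It is an analytic function of B»), which contains `0` when `a, j > 0`.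
[cite: Balaban1987RG1, (4.3) p.281] -/
theorem contDiffAt_chartH179_zero (R : Regime 𝒢 0 W B₀ θ C₄ a₃ j a ε₄) (hWa : AnalyticOnNhd ℂ W {Y : 𝒴 | ‖Y‖ < a₃})
    {Tm : 𝒴 → 𝒴} (hTm : AnalyticOnNhd ℂ Tm {Y : 𝒴 | ‖Y‖ < ε₄ + a}) (hj : 0 < j) (ha : 0 < a) {m : WithTop ℕ∞} :
    ContDiffAt ℂ m (chartH179 𝒢 W D2 H₀ Tm ε₄) 0 := by
  have h0 : (0 : 𝒳) ∈ {B : 𝒳 | ‖H₀ B‖ < a ∧ ‖D2 (H₀ B)‖ < j} := by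
    simp [ha, hj]
  exact (analyticOnNhd_chartH179 (D2 := D2) R hWa hTm 0 h0).contDiffAt

/-- **The p. 282 block bound FOR [15]'s CHART (179)**: with a radius `r > 0` such that `‖B‖ < r ⇒ ‖H₀B‖ < a ∧ ‖Δ⁽²⁾H₀B‖ < j`,
`‖⟨δ^{n(p)}𝓗(0)/δB^{n(p)}, ⊗_{i∈N(p)}B_i⟩‖ ≤ K(ε₄ + a)·(2n(p)/r)^{n(p)}·Π_{i∈N(p)} ‖B_i‖` — «can be estimated by B₃ Π_{i∈N(p)}|B_i|» with an
explicit Cauchy constant, from the analyticity and boundedness of the chart. [cite: Balaban1987RG1, p.282] -/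
theorem norm_blockIns_chartH179_le (R : Regime 𝒢 0 W B₀ θ C₄ a₃ j a ε₄) (hWa : AnalyticOnNhd ℂ W {Y : 𝒴 | ‖Y‖ < a₃})
    {Tm : 𝒴 → 𝒴} (hTm : AnalyticOnNhd ℂ Tm {Y : 𝒴 | ‖Y‖ < ε₄ + a}) {K : ℝ} (hK : 0 ≤ K) (hT0 : Tm 0 = 0)
    (hT : ∀ x y : 𝒴, ‖x‖ < ε₄ + a → ‖y‖ < ε₄ + a → ‖Tm x - Tm y‖ ≤ K * ‖x - y‖)
    {r : ℝ} (hr : 0 < r) (hdom : ∀ B : 𝒳, ‖B‖ < r → ‖H₀ B‖ < a ∧ ‖D2 (H₀ B)‖ < j)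
    {n : ℕ} (B : Fin n → 𝒳) (c : OrderedFinpartition n) (p : Fin c.length) :
    ‖blockIns (𝕜 := ℂ) (chartH179 𝒢 W D2 H₀ Tm ε₄) 0 B c p‖ ≤
      K * (ε₄ + a) * (2 * (c.partSize p : ℝ) / r) ^ c.partSize p * ∏ q, ‖B (c.emb p q)‖ :=
  norm_blockIns_le_of_analytic (isOpen_dom180 (H₀ := H₀) (a := a) (D2 := D2) (j := j)) hr
    (fun B hB => hdom B (mem_ball_zero_iff.1 hB)) (analyticOnNhd_chartH179 R hWa hTm)
    (fun B hB => norm_chartH179_le R hK hT0 hT (hdom B (mem_ball_zero_iff.1 hB)).1 (hdom B (mem_ball_zero_iff.1 hB)).2.le) B c p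

variable {F : Type*} [NormedAddCommGroup F] [NormedSpace ℂ F] [CompleteSpace F]

/-- **THE WHOLE CHAIN (4.3) WITH THE INNER MAP = [15]'s CHART (179)** (`B12Eq43ContourFormula.faaDiBruno_torusIntegral` with `hH`, `hH0`
DISCHARGED): for the outer map `f` (`𝐇 ↦ 𝐄^{(j)}(X, exp iξ𝐇)`) analytic on an open `U ∋ 0` of `𝒴` and radii `ρ_c > 0` whose closed
polydiscs spanned by the block insertions of `𝓗` lie in `U`,
`Dⁿ(f∘𝓗)(0)[B_1,…,B_n] = Σ_c (2πi)^{-r(c)} ∯_{T(0,ρ_c)} Π_pτ_p^{-2} f(Σ_p τ_p ⟨δ^{n(p)}𝓗(0), ⊗_{i∈N(p)}B_i⟩) dτ`.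
[cite: Balaban1987RG1, (4.3) p.281] -/
theorem faaDiBruno_torusIntegral_chartH179 (R : Regime 𝒢 0 W B₀ θ C₄ a₃ j a ε₄) (hWa : AnalyticOnNhd ℂ W {Y : 𝒴 | ‖Y‖ < a₃})
    {Tm : 𝒴 → 𝒴} (hTm : AnalyticOnNhd ℂ Tm {Y : 𝒴 | ‖Y‖ < ε₄ + a}) (hT0 : Tm 0 = 0) (hj : 0 < j) (ha : 0 < a)
    {U : Set 𝒴} (hU : IsOpen U) (h0 : (0 : 𝒴) ∈ U) {f : 𝒴 → F} (hf : AnalyticOnNhd ℂ f U) {n : ℕ} (B : Fin n → 𝒳)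
    (ρ : (c : OrderedFinpartition n) → Fin c.length → ℝ) (hρ : ∀ c p, 0 < ρ c p)
    (hsub : ∀ c, polydisc (0 : 𝒴) (blockIns (𝕜 := ℂ) (chartH179 𝒢 W D2 H₀ Tm ε₄) 0 B c) (ρ c) ⊆ U) :
    iteratedFDeriv ℂ n (f ∘ chartH179 𝒢 W D2 H₀ Tm ε₄) 0 B = ∑ c : OrderedFinpartition n,
      ((2 * Real.pi * I)⁻¹) ^ c.length •
        ∯ τ in T(0, ρ c), (∏ p, 1 / τ p ^ 2) • f (∑ p, τ p • blockIns (𝕜 := ℂ) (chartH179 𝒢 W D2 H₀ Tm ε₄) 0 B c p) :=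
  faaDiBruno_torusIntegral hU h0 hf (contDiffAt_chartH179_zero R hWa hTm hj ha) (chartH179_zero R hj.le ha hT0) B ρ hρ hsub

/-- **The (4.5)-bound WITH THE INNER MAP = [15]'s CHART (179)**: `hH`, `hH0` and the block bound `hv` DISCHARGED
(`B₃ := K(ε₄ + a)·max{1, 2n/r}ⁿ`); kept as printed inputs: (4.4) analyticity of `f` on an open `U ⊇ {‖𝐇‖ < α₂}` with the sup `S` of (1.18),
the localised block factor `W₀ ∈ [0,1]` for the blocks meeting `out` (`hvloc`, Sect. G [15] decay), `2B₃ ≥ α₂`.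
`‖Dⁿ(f∘𝓗)(0)[B_1,…,B_n]‖ ≤ (2n²B₃/α₂)ⁿ · S · W₀ · Π_i ‖B_i‖`. [cite: Balaban1987RG1, (4.3)–(4.5) pp.281–282] -/
theorem norm_iteratedFDeriv_comp_chartH179_le (R : Regime 𝒢 0 W B₀ θ C₄ a₃ j a ε₄) (hWa : AnalyticOnNhd ℂ W {Y : 𝒴 | ‖Y‖ < a₃})
    {Tm : 𝒴 → 𝒴} (hTm : AnalyticOnNhd ℂ Tm {Y : 𝒴 | ‖Y‖ < ε₄ + a}) {K : ℝ} (hK : 0 ≤ K) (hT0 : Tm 0 = 0)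
    (hT : ∀ x y : 𝒴, ‖x‖ < ε₄ + a → ‖y‖ < ε₄ + a → ‖Tm x - Tm y‖ ≤ K * ‖x - y‖)
    {r : ℝ} (hr : 0 < r) (hdom : ∀ B : 𝒳, ‖B‖ < r → ‖H₀ B‖ < a ∧ ‖D2 (H₀ B)‖ < j) (hj : 0 < j) (ha : 0 < a)
    {U : Set 𝒴} (hU : IsOpen U) {α₂ S : ℝ} (hα : 0 < α₂) (hballU : ball (0 : 𝒴) α₂ ⊆ U) {f : 𝒴 → F}
    (hf : AnalyticOnNhd ℂ f U) (hS : ∀ y ∈ ball (0 : 𝒴) α₂, ‖f y‖ ≤ S)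
    {n : ℕ} (B : Fin n → 𝒳) {W₀ : ℝ} (hW0 : 0 ≤ W₀) (hW1 : W₀ ≤ 1)
    (hB : α₂ ≤ 2 * (K * (ε₄ + a) * (max 1 (2 * (n : ℝ) / r)) ^ n)) (out : Fin n → Prop) (i₀ : Fin n) (hi₀ : out i₀)
    (hvloc : ∀ (c : OrderedFinpartition n) (p : Fin c.length), (∃ q, out (c.emb p q)) →
      ‖blockIns (𝕜 := ℂ) (chartH179 𝒢 W D2 H₀ Tm ε₄) 0 B c p‖ ≤
        W₀ * ((K * (ε₄ + a) * (max 1 (2 * (n : ℝ) / r)) ^ n) * ∏ q, ‖B (c.emb p q)‖)) :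
    ‖iteratedFDeriv ℂ n (f ∘ chartH179 𝒢 W D2 H₀ Tm ε₄) 0 B‖ ≤
      (2 * (n : ℝ) ^ 2 * (K * (ε₄ + a) * (max 1 (2 * (n : ℝ) / r)) ^ n) / α₂) ^ n * S * W₀ * ∏ i, ‖B i‖ :=
  norm_iteratedFDeriv_comp_le_of_analytic hU hα hballU hf hS (isOpen_dom180 (H₀ := H₀) (a := a) (D2 := D2) (j := j)) hr
    (fun B hB => hdom B (mem_ball_zero_iff.1 hB)) (analyticOnNhd_chartH179 R hWa hTm)
    (fun B hB => norm_chartH179_le R hK hT0 hT (hdom B (mem_ball_zero_iff.1 hB)).1 (hdom B (mem_ball_zero_iff.1 hB)).2.le)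
    (chartH179_zero R hj.le ha hT0) B hW0 hW1 hB out i₀ hi₀ hvloc

end Chart

end Literature.MathematicalPhysics.QuantumFieldTheory.Balaban1983to89.B12Eq45BlockBound

end
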